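import Mathlib.Algebra.Order.Chebyshev
import Mathlib.Analysis.SpecialFunctions.Pow.Real
import HarnessLib

/-!
# Type-sorted quadratic forms: a quadratic form whose matrix is exchangeable within types is the
# type-constant form plus the diagonal excesses

Cell pnp-psdrank (literature seat g40). Pure finite algebra, the input named for the step «(CG_1′) for
`H`-symmetric masks in EVERY direction from the type-constant directions» (prover MEMO-25 §2, MEMO-28 §4:
«the general-`|v_e|` diagonal excess»). Setting: a finite index set `E` (in the cell: the edges of a perfect
matching), a type map `τ : E → T` (the three `H`-types of an edge) with values in a finite set `Ty`, and a
real matrix `A` on `E` which is EXCHANGEABLE WITHIN TYPES: the diagonal entry `A e e` depends only on `τ e`, the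
off-diagonal entry `A e e'` (`e ≠ e'`) only on `(τ e, τ e')`. Write `E_a = {e ∈ E : τ e = a}`, `m_a = |E_a|`,
`V_a(v) = Σ_{e ∈ E_a} v_e`, `Q_a(v) = Σ_{e ∈ E_a} v_e²`.
* §1 **`sum_sum_mul_mul_eq_typeSorted`** (function form: `A e e = kd (τ e)`, `A e e' = ko (τ e) (τ e')`):
  `Σ_{e,e' ∈ E} v_e v_{e'} A e e' = Σ_a (kd a − ko a a)·Q_a(v) + Σ_{a,b} ko a b·V_a(v)V_b(v)` — the TYPE-SORTED form;
* §2 the TYPE-AVERAGED vector `v̄_e = V_{τe}(v)/m_{τe}`: `V_a(v̄) = V_a(v)`, `Q_a(v̄) = V_a(v)²/m_a`, `|v̄_e| ≤ L` when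
  `|v_e| ≤ L` on `E`, and `0 ≤ Q_a(v) − V_a(v)²/m_a ≤ m_a·L²` (Cauchy–Schwarz);
* §3 **`sum_sum_mul_mul_sub_typeAvg_eq`**: `vᵀAv − v̄ᵀAv̄ = Σ_a (kd a − ko a a)·(Q_a(v) − V_a(v)²/m_a)` — the two forms differ
  by the DIAGONAL EXCESSES `d_a = kd a − ko a a` against nonnegative weights; hence the BOX-SUP REDUCTION
  **`sum_sum_mul_mul_le_typeAvg_add`**: if `|v_e| ≤ L` on `E` and `d_a ≤ D_a`, `0 ≤ D_a` for the types with `m_a ≥ 2`, then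
  `vᵀAv ≤ v̄ᵀAv̄ + L²·Σ_a m_a·D_a` (and the lower companion, and the two-sided form);
* §4 the same in INVARIANCE form (no `kd`, `ko` named: **`sum_sum_mul_mul_le_typeAvg_add_of_exchangeable`**): the hypotheses are
  `τ e = τ e' → A e e = A e' e'` and `e₁ ≠ e₂ → e₁' ≠ e₂' → τ e₁ = τ e₁' → τ e₂ = τ e₂' → A e₁ e₂ = A e₁' e₂'`, the excess bound
  is `A e e − A e e' ≤ D_{τ e}` for distinct `e, e'` of the same type (the canonical `kd`, `ko` are the class averages).
USE (cell pnp-psdrank, next Summits step): with `A = A^ψ_M(e,e') = Σ_U W(U,M)ψ(|U∩H|)·1[e ∪ e' ⊆ U]` (exchangeable within the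
three `H`-types by `ShellLawTypeSortedForms`), `sup_{|v| ≤ L} vᵀAv ≤ sup_{type-constant} + L²Σ_a m_a D_a`, where `D_a` bounds the
design value of the NONNEGATIVE pinned statistic `ψ(|U∩H|)·1[e ⊆ U]·(1 − 1[e' ⊆ U])` — the (O1)-type input, not here.
All PROVED; no definitions, no facts. The type partition is EQUITABLE for such an `A` (every row has constant class sums), so on
type-constant vectors the form is the quotient form [GodsilMeagher2015, §2.2]; the general-vector identity is its one-line
refinement, and the slack bounds are Cauchy–Schwarz (Mathlib `sq_sum_le_card_mul_sum_sq`).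

## References
* [GodsilMeagher2015] C. Godsil, K. Meagher, *Erdős–Ko–Rado Theorems: Algebraic Approaches*, CUP, §2.2 «Equitable partitions»
  (book p. 27; PDF pp. 32–33): a partition whose cells have constant cross-degrees (e.g. the orbits of a group of automorphisms)
  has a quotient matrix which governs the matrix on cell-constant vectors.
* [Rothvoss2017] T. Rothvoß, *The matching polytope has exponential extension complexity*, J. ACM 64 (2017), §2
  (PDF pp. 5–6): the three edge types of a block against a perfect matching (the cell's instance of `τ`).
-/

noncomputable section

open Finset

namespace Literature.Combinatorics.Optimization

namespace TypeSortedForm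

variable {α T : Type*} [DecidableEq T]

/-! ### §1 The type-sorted form -/

/-- Fiberwise summation over the types: `Σ_{e ∈ E} f e = Σ_{a ∈ Ty} Σ_{e ∈ E_a} f e` when `τ(E) ⊆ Ty`. [cite: GodsilMeagher2015, §2.2 (PDF pp. 32–33)] -/
theorem sum_eq_sum_types (E : Finset α) (τ : α → T) (Ty : Finset T) (hτ : ∀ e ∈ E, τ e ∈ Ty) (f : α → ℝ) :
    ∑ e ∈ E, f e = ∑ a ∈ Ty, ∑ e ∈ E.filter (fun e => τ e = a), f e :=
  (sum_fiberwise_of_maps_to hτ f).symm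

/-- Fiberwise summation of a type-dependent factor: `Σ_{e ∈ E} g (τ e)·f e = Σ_{a ∈ Ty} g a·Σ_{e ∈ E_a} f e`. [cite: GodsilMeagher2015, §2.2 (PDF pp. 32–33)] -/
theorem sum_typeFactor_mul_eq (E : Finset α) (τ : α → T) (Ty : Finset T) (hτ : ∀ e ∈ E, τ e ∈ Ty) (g : T → ℝ)
    (f : α → ℝ) :
    ∑ e ∈ E, g (τ e) * f e = ∑ a ∈ Ty, g a * ∑ e ∈ E.filter (fun e => τ e = a), f e := by
  rw [sum_eq_sum_types E τ Ty hτ]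
  refine sum_congr rfl fun a _ => ?_
  rw [mul_sum]
  exact sum_congr rfl fun e he => by rw [(mem_filter.1 he).2]

/-- **The type-sorted form (function form).** If `A e e = kd (τ e)` on `E` and `A e e' = ko (τ e) (τ e')` for distinct
`e, e' ∈ E`, then for every `v`,
`Σ_{e,e'∈E} v_e v_{e'} A e e' = Σ_{a∈Ty} (kd a − ko a a)·Q_a(v) + Σ_{a,b∈Ty} ko a b·V_a(v)·V_b(v)`,
`Q_a(v) = Σ_{e∈E_a} v_e²`, `V_a(v) = Σ_{e∈E_a} v_e`. [cite: GodsilMeagher2015, §2.2 (PDF pp. 32–33)] -/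
theorem sum_sum_mul_mul_eq_typeSorted (E : Finset α) (τ : α → T) (Ty : Finset T) (hτ : ∀ e ∈ E, τ e ∈ Ty)
    (A : α → α → ℝ) (kd : T → ℝ) (ko : T → T → ℝ)
    (hd : ∀ e ∈ E, A e e = kd (τ e)) (ho : ∀ e ∈ E, ∀ e' ∈ E, e ≠ e' → A e e' = ko (τ e) (τ e'))
    (v : α → ℝ) :
    ∑ e ∈ E, ∑ e' ∈ E, v e * v e' * A e e' =
      ∑ a ∈ Ty, (kd a - ko a a) * ∑ e ∈ E.filter (fun e => τ e = a), v e ^ 2 +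
        ∑ a ∈ Ty, ∑ b ∈ Ty, ko a b *
          ((∑ e ∈ E.filter (fun e => τ e = a), v e) * ∑ e ∈ E.filter (fun e => τ e = b), v e) := by
  classical
  -- pointwise: `v_e v_{e'} A e e' = v_e v_{e'} ko(τe,τe') + [e = e']·v_e²·(kd − ko)(τ e)`
  have hpt : ∀ e ∈ E, ∀ e' ∈ E, v e * v e' * A e e' =
      v e * v e' * ko (τ e) (τ e') + if e' = e then v e ^ 2 * (kd (τ e) - ko (τ e) (τ e)) else 0 := by
    intro e he e' he'
    by_cases h : e' = e
    · rw [if_pos h, h, hd e he]; ring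
    · rw [if_neg h, ho e he e' he' (Ne.symm h)]; ring
  have h1 : ∑ e ∈ E, ∑ e' ∈ E, v e * v e' * A e e' =
      ∑ e ∈ E, ∑ e' ∈ E, v e * v e' * ko (τ e) (τ e') + ∑ e ∈ E, v e ^ 2 * (kd (τ e) - ko (τ e) (τ e)) := by
    rw [← sum_add_distrib]
    refine sum_congr rfl fun e he => ?_
    rw [sum_congr rfl fun e' he' => hpt e he e' he', sum_add_distrib, sum_ite_eq' E e, if_pos he]
  -- the diagonal part, sorted by types
  have h2 : ∑ e ∈ E, v e ^ 2 * (kd (τ e) - ko (τ e) (τ e)) =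
      ∑ a ∈ Ty, (kd a - ko a a) * ∑ e ∈ E.filter (fun e => τ e = a), v e ^ 2 := by
    rw [← sum_typeFactor_mul_eq E τ Ty hτ (fun a => kd a - ko a a) (fun e => v e ^ 2)]
    exact sum_congr rfl fun e _ => by ring
  -- the off-diagonal kernel part, sorted by types twice
  have h3 : ∑ e ∈ E, ∑ e' ∈ E, v e * v e' * ko (τ e) (τ e') =
      ∑ a ∈ Ty, ∑ b ∈ Ty, ko a b *
        ((∑ e ∈ E.filter (fun e => τ e = a), v e) * ∑ e ∈ E.filter (fun e => τ e = b), v e) := by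
    -- sort the inner sum by the type of `e'`
    have inner : ∀ e ∈ E, ∑ e' ∈ E, v e * v e' * ko (τ e) (τ e') =
        (∑ b ∈ Ty, ko (τ e) b * ∑ e' ∈ E.filter (fun e' => τ e' = b), v e') * v e := by
      intro e _
      rw [← sum_typeFactor_mul_eq E τ Ty hτ (fun b => ko (τ e) b) v, sum_mul]
      exact sum_congr rfl fun e' _ => by ring
    rw [sum_congr rfl inner]
    -- sort the outer sum by the type of `e`
    rw [sum_typeFactor_mul_eq E τ Ty hτ (fun a => ∑ b ∈ Ty, ko a b * ∑ e' ∈ E.filter (fun e' => τ e' = b), v e') v]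
    refine sum_congr rfl fun a _ => ?_
    rw [sum_mul]
    exact sum_congr rfl fun b _ => by ring
  rw [h1, h2, h3, add_comm]

/-- **The type-sorted form at a TYPE-CONSTANT vector** `v_e = s (τ e)`: `Q_a = m_a s_a²`, `V_a = m_a s_a`, so
`Σ_{e,e'} v_e v_{e'} A e e' = Σ_a (kd a − ko a a)·m_a s_a² + Σ_{a,b} ko a b·(m_a s_a)(m_b s_b)`. [cite: GodsilMeagher2015, §2.2 (PDF pp. 32–33)] -/
theorem sum_sum_mul_mul_eq_typeSorted_const (E : Finset α) (τ : α → T) (Ty : Finset T) (hτ : ∀ e ∈ E, τ e ∈ Ty)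
    (A : α → α → ℝ) (kd : T → ℝ) (ko : T → T → ℝ)
    (hd : ∀ e ∈ E, A e e = kd (τ e)) (ho : ∀ e ∈ E, ∀ e' ∈ E, e ≠ e' → A e e' = ko (τ e) (τ e'))
    (s : T → ℝ) :
    ∑ e ∈ E, ∑ e' ∈ E, s (τ e) * s (τ e') * A e e' =
      ∑ a ∈ Ty, (kd a - ko a a) * ((E.filter (fun e => τ e = a)).card * s a ^ 2) +
        ∑ a ∈ Ty, ∑ b ∈ Ty, ko a b *
          (((E.filter (fun e => τ e = a)).card * s a) * ((E.filter (fun e => τ e = b)).card * s b)) := by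
  rw [sum_sum_mul_mul_eq_typeSorted E τ Ty hτ A kd ko hd ho (fun e => s (τ e))]
  have hQ : ∀ a : T, ∑ e ∈ E.filter (fun e => τ e = a), s (τ e) ^ 2 = (E.filter (fun e => τ e = a)).card * s a ^ 2 := by
    intro a
    rw [sum_congr rfl fun e he => by rw [(mem_filter.1 he).2], sum_const, nsmul_eq_mul]
  have hV : ∀ a : T, ∑ e ∈ E.filter (fun e => τ e = a), s (τ e) = (E.filter (fun e => τ e = a)).card * s a := by
    intro a
    rw [sum_congr rfl fun e he => by rw [(mem_filter.1 he).2], sum_const, nsmul_eq_mul]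
  simp only [hQ, hV]

/-! ### §2 The type-averaged vector -/

/-- The class sum of the type-averaged vector is the class sum: `Σ_{e∈E_a} V_a/m_a = V_a`. [cite: GodsilMeagher2015, §2.2 (PDF pp. 32–33)] -/
theorem sum_typeAvg_eq (E : Finset α) (τ : α → T) (v : α → ℝ) (a : T) :
    ∑ e ∈ E.filter (fun e => τ e = a),
        (∑ e' ∈ E.filter (fun e' => τ e' = τ e), v e') / ((E.filter (fun e' => τ e' = τ e)).card : ℝ) =
      ∑ e ∈ E.filter (fun e => τ e = a), v e := by
  rw [sum_congr rfl fun e he => by rw [(mem_filter.1 he).2], sum_const, nsmul_eq_mul]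
  by_cases hm : (E.filter (fun e => τ e = a)).card = 0
  · rw [hm, card_eq_zero.1 hm]; simp
  · field_simp

/-- The class sum of squares of the type-averaged vector: `Σ_{e∈E_a} (V_a/m_a)² = V_a²/m_a`. [cite: GodsilMeagher2015, §2.2 (PDF pp. 32–33)] -/
theorem sum_typeAvg_sq_eq (E : Finset α) (τ : α → T) (v : α → ℝ) (a : T) :
    ∑ e ∈ E.filter (fun e => τ e = a),
        ((∑ e' ∈ E.filter (fun e' => τ e' = τ e), v e') / ((E.filter (fun e' => τ e' = τ e)).card : ℝ)) ^ 2 =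
      (∑ e ∈ E.filter (fun e => τ e = a), v e) ^ 2 / ((E.filter (fun e => τ e = a)).card : ℝ) := by
  rw [sum_congr rfl fun e he => by rw [(mem_filter.1 he).2], sum_const, nsmul_eq_mul]
  by_cases hm : (E.filter (fun e => τ e = a)).card = 0
  · rw [hm, card_eq_zero.1 hm]; simp
  · field_simp

/-- The type-averaged vector inherits the box bound: `|v_e| ≤ L` on `E` implies `|V_{τe}/m_{τe}| ≤ L` for `e ∈ E`.
[cite: GodsilMeagher2015, §2.2 (PDF pp. 32–33)] -/
theorem abs_typeAvg_le (E : Finset α) (τ : α → T) (v : α → ℝ) {L : ℝ} (hv : ∀ e ∈ E, |v e| ≤ L) {e : α}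
    (he : e ∈ E) :
    |(∑ e' ∈ E.filter (fun e' => τ e' = τ e), v e') / ((E.filter (fun e' => τ e' = τ e)).card : ℝ)| ≤ L := by
  have hmem : e ∈ E.filter (fun e' => τ e' = τ e) := mem_filter.2 ⟨he, rfl⟩
  have hm : (0 : ℝ) < (E.filter (fun e' => τ e' = τ e)).card := by exact_mod_cast card_pos.2 ⟨e, hmem⟩
  rw [abs_div, abs_of_pos hm, div_le_iff₀ hm]
  calc |∑ e' ∈ E.filter (fun e' => τ e' = τ e), v e'| ≤ ∑ e' ∈ E.filter (fun e' => τ e' = τ e), |v e'| :=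
        abs_sum_le_sum_abs _ _
    _ ≤ ∑ _e' ∈ E.filter (fun e' => τ e' = τ e), L := sum_le_sum fun e' he' => hv e' (mem_filter.1 he').1
    _ = L * (E.filter (fun e' => τ e' = τ e)).card := by rw [sum_const, nsmul_eq_mul, mul_comm]

/-- **Cauchy–Schwarz slack of a class**: `0 ≤ Q_a(v) − V_a(v)²/m_a`. [cite: GodsilMeagher2015, §2.2 (PDF pp. 32–33)] -/
theorem sub_sq_div_card_nonneg (E : Finset α) (τ : α → T) (v : α → ℝ) (a : T) :
    0 ≤ ∑ e ∈ E.filter (fun e => τ e = a), v e ^ 2 -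
      (∑ e ∈ E.filter (fun e => τ e = a), v e) ^ 2 / ((E.filter (fun e => τ e = a)).card : ℝ) := by
  by_cases hm : (E.filter (fun e => τ e = a)).card = 0
  · rw [hm, card_eq_zero.1 hm]; simp
  · have hmpos : (0 : ℝ) < (E.filter (fun e => τ e = a)).card := by exact_mod_cast Nat.pos_of_ne_zero hm
    rw [sub_nonneg, div_le_iff₀ hmpos, mul_comm]
    exact sq_sum_le_card_mul_sum_sq

/-- **The slack is at most the class size times the box**: `|v_e| ≤ L` on `E` gives
`Q_a(v) − V_a(v)²/m_a ≤ Q_a(v) ≤ m_a·L²`. [cite: GodsilMeagher2015, §2.2 (PDF pp. 32–33)] -/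
theorem sub_sq_div_card_le (E : Finset α) (τ : α → T) (v : α → ℝ) {L : ℝ} (hv : ∀ e ∈ E, |v e| ≤ L) (a : T) :
    ∑ e ∈ E.filter (fun e => τ e = a), v e ^ 2 -
        (∑ e ∈ E.filter (fun e => τ e = a), v e) ^ 2 / ((E.filter (fun e => τ e = a)).card : ℝ) ≤
      (E.filter (fun e => τ e = a)).card * L ^ 2 := by
  have h1 : (0 : ℝ) ≤ (∑ e ∈ E.filter (fun e => τ e = a), v e) ^ 2 / ((E.filter (fun e => τ e = a)).card : ℝ) :=
    by positivity
  have h2 : ∑ e ∈ E.filter (fun e => τ e = a), v e ^ 2 ≤ ∑ _e ∈ E.filter (fun e => τ e = a), L ^ 2 := by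
    refine sum_le_sum fun e he => ?_
    have h := hv e (mem_filter.1 he).1
    have hL : 0 ≤ L := (abs_nonneg _).trans h
    nlinarith [abs_le.1 h, sq_abs (v e), abs_nonneg (v e)]
  rw [sum_const, nsmul_eq_mul] at h2
  linarith

/-- **For a class with at most one element the slack vanishes**: `m_a ≤ 1 ⟹ Q_a(v) − V_a(v)²/m_a = 0`. [cite: GodsilMeagher2015, §2.2 (PDF pp. 32–33)] -/
theorem sub_sq_div_card_eq_zero_of_card_le_one (E : Finset α) (τ : α → T) (v : α → ℝ) (a : T)
    (hm : (E.filter (fun e => τ e = a)).card ≤ 1) :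
    ∑ e ∈ E.filter (fun e => τ e = a), v e ^ 2 -
      (∑ e ∈ E.filter (fun e => τ e = a), v e) ^ 2 / ((E.filter (fun e => τ e = a)).card : ℝ) = 0 := by
  rcases Nat.le_one_iff_eq_zero_or_eq_one.1 hm with h0 | h1
  · rw [h0, card_eq_zero.1 h0]; simp
  · obtain ⟨e, he⟩ := card_eq_one.1 h1
    rw [h1, he]; simp

/-! ### §3 Comparison with the type-averaged vector; the box-sup reduction -/

/-- **The two forms differ by the diagonal excesses.** With `v̄_e = V_{τe}(v)/m_{τe}`:
`Σ v_e v_{e'} A e e' − Σ v̄_e v̄_{e'} A e e' = Σ_{a∈Ty} (kd a − ko a a)·(Q_a(v) − V_a(v)²/m_a)`. [cite: GodsilMeagher2015, §2.2 (PDF pp. 32–33)] -/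
theorem sum_sum_mul_mul_sub_typeAvg_eq (E : Finset α) (τ : α → T) (Ty : Finset T) (hτ : ∀ e ∈ E, τ e ∈ Ty)
    (A : α → α → ℝ) (kd : T → ℝ) (ko : T → T → ℝ)
    (hd : ∀ e ∈ E, A e e = kd (τ e)) (ho : ∀ e ∈ E, ∀ e' ∈ E, e ≠ e' → A e e' = ko (τ e) (τ e'))
    (v : α → ℝ) :
    ∑ e ∈ E, ∑ e' ∈ E, v e * v e' * A e e' -
        ∑ e ∈ E, ∑ e' ∈ E,
          ((∑ x ∈ E.filter (fun x => τ x = τ e), v x) / ((E.filter (fun x => τ x = τ e)).card : ℝ)) *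
            ((∑ x ∈ E.filter (fun x => τ x = τ e'), v x) / ((E.filter (fun x => τ x = τ e')).card : ℝ)) *
              A e e' =
      ∑ a ∈ Ty, (kd a - ko a a) *
        (∑ e ∈ E.filter (fun e => τ e = a), v e ^ 2 -
          (∑ e ∈ E.filter (fun e => τ e = a), v e) ^ 2 / ((E.filter (fun e => τ e = a)).card : ℝ)) := by
  rw [sum_sum_mul_mul_eq_typeSorted E τ Ty hτ A kd ko hd ho v,
    sum_sum_mul_mul_eq_typeSorted E τ Ty hτ A kd ko hd ho
      (fun e => (∑ x ∈ E.filter (fun x => τ x = τ e), v x) / ((E.filter (fun x => τ x = τ e)).card : ℝ))]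
  simp only [sum_typeAvg_eq, sum_typeAvg_sq_eq]
  rw [add_sub_add_right_eq_sub, ← sum_sub_distrib]
  exact sum_congr rfl fun a _ => by ring

/-- **BOX-SUP REDUCTION (upper).** If `|v_e| ≤ L` on `E` and the diagonal excess of every type with at least two
elements is bounded, `kd a − ko a a ≤ D_a` with `0 ≤ D_a` on `Ty`, then
`Σ v_e v_{e'} A e e' ≤ Σ v̄_e v̄_{e'} A e e' + L²·Σ_{a∈Ty} m_a·D_a` — the form at a general box vector is at most the form
at a TYPE-CONSTANT box vector plus the excess budget. [cite: GodsilMeagher2015, §2.2 (PDF pp. 32–33)] -/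
theorem sum_sum_mul_mul_le_typeAvg_add (E : Finset α) (τ : α → T) (Ty : Finset T) (hτ : ∀ e ∈ E, τ e ∈ Ty)
    (A : α → α → ℝ) (kd : T → ℝ) (ko : T → T → ℝ)
    (hd : ∀ e ∈ E, A e e = kd (τ e)) (ho : ∀ e ∈ E, ∀ e' ∈ E, e ≠ e' → A e e' = ko (τ e) (τ e'))
    (v : α → ℝ) {L : ℝ} (hv : ∀ e ∈ E, |v e| ≤ L) (D : T → ℝ) (hD0 : ∀ a ∈ Ty, 0 ≤ D a)
    (hD : ∀ a ∈ Ty, 2 ≤ (E.filter (fun e => τ e = a)).card → kd a - ko a a ≤ D a) :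
    ∑ e ∈ E, ∑ e' ∈ E, v e * v e' * A e e' ≤
      ∑ e ∈ E, ∑ e' ∈ E,
          ((∑ x ∈ E.filter (fun x => τ x = τ e), v x) / ((E.filter (fun x => τ x = τ e)).card : ℝ)) *
            ((∑ x ∈ E.filter (fun x => τ x = τ e'), v x) / ((E.filter (fun x => τ x = τ e')).card : ℝ)) *
              A e e' +
        L ^ 2 * ∑ a ∈ Ty, ((E.filter (fun e => τ e = a)).card : ℝ) * D a := by
  have h := sum_sum_mul_mul_sub_typeAvg_eq E τ Ty hτ A kd ko hd ho v
  have key : ∑ a ∈ Ty, (kd a - ko a a) *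
      (∑ e ∈ E.filter (fun e => τ e = a), v e ^ 2 -
        (∑ e ∈ E.filter (fun e => τ e = a), v e) ^ 2 / ((E.filter (fun e => τ e = a)).card : ℝ)) ≤
      L ^ 2 * ∑ a ∈ Ty, ((E.filter (fun e => τ e = a)).card : ℝ) * D a := by
    rw [mul_sum]
    refine sum_le_sum fun a ha => ?_
    by_cases hm : 2 ≤ (E.filter (fun e => τ e = a)).card
    · calc (kd a - ko a a) * (∑ e ∈ E.filter (fun e => τ e = a), v e ^ 2 -
            (∑ e ∈ E.filter (fun e => τ e = a), v e) ^ 2 / ((E.filter (fun e => τ e = a)).card : ℝ))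
          ≤ D a * (∑ e ∈ E.filter (fun e => τ e = a), v e ^ 2 -
            (∑ e ∈ E.filter (fun e => τ e = a), v e) ^ 2 / ((E.filter (fun e => τ e = a)).card : ℝ)) :=
            mul_le_mul_of_nonneg_right (hD a ha hm) (sub_sq_div_card_nonneg E τ v a)
        _ ≤ D a * ((E.filter (fun e => τ e = a)).card * L ^ 2) :=
            mul_le_mul_of_nonneg_left (sub_sq_div_card_le E τ v hv a) (hD0 a ha)
        _ = L ^ 2 * (((E.filter (fun e => τ e = a)).card : ℝ) * D a) := by ring
    · rw [sub_sq_div_card_eq_zero_of_card_le_one E τ v a (by omega), mul_zero]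
      have hL : 0 ≤ L ^ 2 := sq_nonneg L
      have := hD0 a ha
      positivity
  linarith

/-- **BOX-SUP REDUCTION (lower companion).** If `|v_e| ≤ L` on `E` and `−D_a ≤ kd a − ko a a`, `0 ≤ D_a` for the types
with at least two elements, then `Σ v̄_e v̄_{e'} A e e' − L²·Σ_a m_a·D_a ≤ Σ v_e v_{e'} A e e'`. [cite: GodsilMeagher2015, §2.2 (PDF pp. 32–33)] -/
theorem typeAvg_sub_le_sum_sum_mul_mul (E : Finset α) (τ : α → T) (Ty : Finset T) (hτ : ∀ e ∈ E, τ e ∈ Ty)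
    (A : α → α → ℝ) (kd : T → ℝ) (ko : T → T → ℝ)
    (hd : ∀ e ∈ E, A e e = kd (τ e)) (ho : ∀ e ∈ E, ∀ e' ∈ E, e ≠ e' → A e e' = ko (τ e) (τ e'))
    (v : α → ℝ) {L : ℝ} (hv : ∀ e ∈ E, |v e| ≤ L) (D : T → ℝ) (hD0 : ∀ a ∈ Ty, 0 ≤ D a)
    (hD : ∀ a ∈ Ty, 2 ≤ (E.filter (fun e => τ e = a)).card → -D a ≤ kd a - ko a a) :
    ∑ e ∈ E, ∑ e' ∈ E,
          ((∑ x ∈ E.filter (fun x => τ x = τ e), v x) / ((E.filter (fun x => τ x = τ e)).card : ℝ)) *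
            ((∑ x ∈ E.filter (fun x => τ x = τ e'), v x) / ((E.filter (fun x => τ x = τ e')).card : ℝ)) *
              A e e' -
        L ^ 2 * ∑ a ∈ Ty, ((E.filter (fun e => τ e = a)).card : ℝ) * D a ≤
      ∑ e ∈ E, ∑ e' ∈ E, v e * v e' * A e e' := by
  have h := sum_sum_mul_mul_sub_typeAvg_eq E τ Ty hτ A kd ko hd ho v
  have key : -(L ^ 2 * ∑ a ∈ Ty, ((E.filter (fun e => τ e = a)).card : ℝ) * D a) ≤
      ∑ a ∈ Ty, (kd a - ko a a) *
        (∑ e ∈ E.filter (fun e => τ e = a), v e ^ 2 -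
          (∑ e ∈ E.filter (fun e => τ e = a), v e) ^ 2 / ((E.filter (fun e => τ e = a)).card : ℝ)) := by
    rw [mul_sum, ← sum_neg_distrib]
    refine sum_le_sum fun a ha => ?_
    by_cases hm : 2 ≤ (E.filter (fun e => τ e = a)).card
    · have h0 := sub_sq_div_card_nonneg E τ v a
      have h1 := sub_sq_div_card_le E τ v hv a
      have h2 := hD a ha hm
      have h3 := hD0 a ha
      calc -(L ^ 2 * (((E.filter (fun e => τ e = a)).card : ℝ) * D a))
          = (-D a) * ((E.filter (fun e => τ e = a)).card * L ^ 2) := by ring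
        _ ≤ (-D a) * (∑ e ∈ E.filter (fun e => τ e = a), v e ^ 2 -
            (∑ e ∈ E.filter (fun e => τ e = a), v e) ^ 2 / ((E.filter (fun e => τ e = a)).card : ℝ)) :=
            mul_le_mul_of_nonpos_left h1 (by linarith)
        _ ≤ (kd a - ko a a) * (∑ e ∈ E.filter (fun e => τ e = a), v e ^ 2 -
            (∑ e ∈ E.filter (fun e => τ e = a), v e) ^ 2 / ((E.filter (fun e => τ e = a)).card : ℝ)) :=
            mul_le_mul_of_nonneg_right h2 h0
    · rw [sub_sq_div_card_eq_zero_of_card_le_one E τ v a (by omega), mul_zero, neg_nonpos]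
      have hL : 0 ≤ L ^ 2 := sq_nonneg L
      have := hD0 a ha
      positivity
  linarith

/-- **BOX-SUP REDUCTION (two-sided).** If `|v_e| ≤ L` on `E` and `|kd a − ko a a| ≤ D_a` for the types with at least two
elements (`0 ≤ D_a` on `Ty`), then `|Σ v_e v_{e'} A e e' − Σ v̄_e v̄_{e'} A e e'| ≤ L²·Σ_a m_a·D_a`. [cite: GodsilMeagher2015, §2.2 (PDF pp. 32–33)] -/
theorem abs_sum_sum_mul_mul_sub_typeAvg_le (E : Finset α) (τ : α → T) (Ty : Finset T) (hτ : ∀ e ∈ E, τ e ∈ Ty)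
    (A : α → α → ℝ) (kd : T → ℝ) (ko : T → T → ℝ)
    (hd : ∀ e ∈ E, A e e = kd (τ e)) (ho : ∀ e ∈ E, ∀ e' ∈ E, e ≠ e' → A e e' = ko (τ e) (τ e'))
    (v : α → ℝ) {L : ℝ} (hv : ∀ e ∈ E, |v e| ≤ L) (D : T → ℝ) (hD0 : ∀ a ∈ Ty, 0 ≤ D a)
    (hD : ∀ a ∈ Ty, 2 ≤ (E.filter (fun e => τ e = a)).card → |kd a - ko a a| ≤ D a) :
    |∑ e ∈ E, ∑ e' ∈ E, v e * v e' * A e e' -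
        ∑ e ∈ E, ∑ e' ∈ E,
          ((∑ x ∈ E.filter (fun x => τ x = τ e), v x) / ((E.filter (fun x => τ x = τ e)).card : ℝ)) *
            ((∑ x ∈ E.filter (fun x => τ x = τ e'), v x) / ((E.filter (fun x => τ x = τ e')).card : ℝ)) *
              A e e'| ≤
      L ^ 2 * ∑ a ∈ Ty, ((E.filter (fun e => τ e = a)).card : ℝ) * D a := by
  have hup := sum_sum_mul_mul_le_typeAvg_add E τ Ty hτ A kd ko hd ho v hv D hD0
    (fun a ha hm => (le_abs_self _).trans (hD a ha hm))
  have hlo := typeAvg_sub_le_sum_sum_mul_mul E τ Ty hτ A kd ko hd ho v hv D hD0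
    (fun a ha hm => (neg_le.2 ((neg_le_abs _).trans (hD a ha hm))))
  rw [abs_le]; constructor <;> linarith

/-! ### §4 Invariance form: the canonical `kd`, `ko` are the class averages -/

/-- If the diagonal entries are constant on a class, each equals the class average. [cite: GodsilMeagher2015, §2.2 (PDF pp. 32–33)] -/
theorem diag_eq_classAvg (E : Finset α) (τ : α → T) (A : α → α → ℝ)
    (hdiag : ∀ e ∈ E, ∀ e' ∈ E, τ e = τ e' → A e e = A e' e') {e : α} (he : e ∈ E) :
    A e e = (∑ x ∈ E.filter (fun x => τ x = τ e), A x x) / ((E.filter (fun x => τ x = τ e)).card : ℝ) := by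
  have hmem : e ∈ E.filter (fun x => τ x = τ e) := mem_filter.2 ⟨he, rfl⟩
  have hm : (0 : ℝ) < (E.filter (fun x => τ x = τ e)).card := by exact_mod_cast card_pos.2 ⟨e, hmem⟩
  rw [sum_congr rfl fun x hx => hdiag x (mem_filter.1 hx).1 e he (mem_filter.1 hx).2, sum_const, nsmul_eq_mul]
  field_simp

/-- If the off-diagonal entries depend only on the ordered pair of types, each equals the average over the ordered
pairs of distinct elements of the two classes. [cite: GodsilMeagher2015, §2.2 (PDF pp. 32–33)] -/
theorem offDiag_eq_classAvg [DecidableEq α] (E : Finset α) (τ : α → T) (A : α → α → ℝ)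
    (hoff : ∀ e₁ ∈ E, ∀ e₂ ∈ E, ∀ e₁' ∈ E, ∀ e₂' ∈ E, e₁ ≠ e₂ → e₁' ≠ e₂' → τ e₁ = τ e₁' → τ e₂ = τ e₂' →
      A e₁ e₂ = A e₁' e₂') {e e' : α} (he : e ∈ E) (he' : e' ∈ E) (hne : e ≠ e') :
    A e e' = (∑ p ∈ ((E.filter (fun x => τ x = τ e)) ×ˢ (E.filter (fun x => τ x = τ e'))).filter
        (fun p => p.1 ≠ p.2), A p.1 p.2) /
      ((((E.filter (fun x => τ x = τ e)) ×ˢ (E.filter (fun x => τ x = τ e'))).filter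
        (fun p => p.1 ≠ p.2)).card : ℝ) := by
  set P := ((E.filter (fun x => τ x = τ e)) ×ˢ (E.filter (fun x => τ x = τ e'))).filter (fun p => p.1 ≠ p.2)
    with hP
  have hmem : (e, e') ∈ P := by
    rw [hP, mem_filter, mem_product]
    exact ⟨⟨mem_filter.2 ⟨he, rfl⟩, mem_filter.2 ⟨he', rfl⟩⟩, hne⟩
  have hm : (0 : ℝ) < P.card := by exact_mod_cast card_pos.2 ⟨_, hmem⟩
  have hall : ∀ p ∈ P, A p.1 p.2 = A e e' := by
    intro p hp
    rw [hP, mem_filter, mem_product] at hp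
    obtain ⟨⟨h1, h2⟩, h3⟩ := hp
    exact hoff p.1 (mem_filter.1 h1).1 p.2 (mem_filter.1 h2).1 e he e' he' h3 hne (mem_filter.1 h1).2
      (mem_filter.1 h2).2
  rw [sum_congr rfl hall, sum_const, nsmul_eq_mul]
  field_simp

/-- **BOX-SUP REDUCTION, invariance form.** Let `A` be exchangeable within the types of `τ` on `E`
(`τ e = τ e' → A e e = A e' e'`; `A e₁ e₂ = A e₁' e₂'` for distinct pairs with the same ordered types). If
`|v_e| ≤ L` on `E` and the DIAGONAL EXCESS of every type is bounded above, `A e e − A e e' ≤ D_{τe}` for all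
distinct `e, e'` of the same type, with `0 ≤ D_a` on `Ty ⊇ τ(E)`, then
`Σ_{e,e'∈E} v_e v_{e'} A e e' ≤ Σ_{e,e'∈E} v̄_e v̄_{e'} A e e' + L²·Σ_{a∈Ty} m_a·D_a`, `v̄_e = V_{τe}(v)/m_{τe}` (a
type-constant vector with `|v̄_e| ≤ L`, `abs_typeAvg_le`). [cite: GodsilMeagher2015, §2.2 (PDF pp. 32–33)] -/
theorem sum_sum_mul_mul_le_typeAvg_add_of_exchangeable (E : Finset α) (τ : α → T) (Ty : Finset T)
    (hτ : ∀ e ∈ E, τ e ∈ Ty) (A : α → α → ℝ)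
    (hdiag : ∀ e ∈ E, ∀ e' ∈ E, τ e = τ e' → A e e = A e' e')
    (hoff : ∀ e₁ ∈ E, ∀ e₂ ∈ E, ∀ e₁' ∈ E, ∀ e₂' ∈ E, e₁ ≠ e₂ → e₁' ≠ e₂' → τ e₁ = τ e₁' → τ e₂ = τ e₂' →
      A e₁ e₂ = A e₁' e₂')
    (v : α → ℝ) {L : ℝ} (hv : ∀ e ∈ E, |v e| ≤ L) (D : T → ℝ) (hD0 : ∀ a ∈ Ty, 0 ≤ D a)
    (hD : ∀ e ∈ E, ∀ e' ∈ E, τ e = τ e' → e ≠ e' → A e e - A e e' ≤ D (τ e)) :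
    ∑ e ∈ E, ∑ e' ∈ E, v e * v e' * A e e' ≤
      ∑ e ∈ E, ∑ e' ∈ E,
          ((∑ x ∈ E.filter (fun x => τ x = τ e), v x) / ((E.filter (fun x => τ x = τ e)).card : ℝ)) *
            ((∑ x ∈ E.filter (fun x => τ x = τ e'), v x) / ((E.filter (fun x => τ x = τ e')).card : ℝ)) *
              A e e' +
        L ^ 2 * ∑ a ∈ Ty, ((E.filter (fun e => τ e = a)).card : ℝ) * D a := by
  classical
  -- the canonical class averages
  let kd : T → ℝ := fun a => (∑ x ∈ E.filter (fun x => τ x = a), A x x) / ((E.filter (fun x => τ x = a)).card : ℝ)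
  let ko : T → T → ℝ := fun a b =>
    (∑ p ∈ ((E.filter (fun x => τ x = a)) ×ˢ (E.filter (fun x => τ x = b))).filter (fun p => p.1 ≠ p.2),
        A p.1 p.2) /
      ((((E.filter (fun x => τ x = a)) ×ˢ (E.filter (fun x => τ x = b))).filter (fun p => p.1 ≠ p.2)).card : ℝ)
  have hd : ∀ e ∈ E, A e e = kd (τ e) := fun e he => diag_eq_classAvg E τ A hdiag he
  have ho : ∀ e ∈ E, ∀ e' ∈ E, e ≠ e' → A e e' = ko (τ e) (τ e') :=
    fun e he e' he' hne => offDiag_eq_classAvg E τ A hoff he he' hne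
  refine sum_sum_mul_mul_le_typeAvg_add E τ Ty hτ A kd ko hd ho v hv D hD0 fun a ha hm => ?_
  -- a type with two elements: pick them and read the excess off the matrix
  obtain ⟨e, he, e', he', hne⟩ : ∃ e ∈ E.filter (fun x => τ x = a), ∃ e' ∈ E.filter (fun x => τ x = a), e ≠ e' :=
    one_lt_card.1 hm
  have heE := (mem_filter.1 he).1
  have he'E := (mem_filter.1 he').1
  have hτe : τ e = a := (mem_filter.1 he).2
  have hτe' : τ e' = a := (mem_filter.1 he').2
  have h1 : kd a = A e e := by rw [← hτe]; exact (hd e heE).symm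
  have h2 : ko a a = A e e' := by
    have := ho e heE e' he'E hne; rw [hτe, hτe'] at this; exact this.symm
  rw [h1, h2, ← hτe]
  exact hD e heE e' he'E (hτe.trans hτe'.symm) hne

/-- **The comparison identity, invariance form**: the excess of the general form over the type-averaged one is
`Σ_{a∈Ty} d_a·(Q_a(v) − V_a(v)²/m_a)` for ANY family `d` with `d_{τe} = A e e − A e e'` on distinct same-type pairs
(types with fewer than two elements contribute zero whatever `d` is). [cite: GodsilMeagher2015, §2.2 (PDF pp. 32–33)] -/
theorem sum_sum_mul_mul_sub_typeAvg_eq_of_exchangeable (E : Finset α) (τ : α → T) (Ty : Finset T)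
    (hτ : ∀ e ∈ E, τ e ∈ Ty) (A : α → α → ℝ)
    (hdiag : ∀ e ∈ E, ∀ e' ∈ E, τ e = τ e' → A e e = A e' e')
    (hoff : ∀ e₁ ∈ E, ∀ e₂ ∈ E, ∀ e₁' ∈ E, ∀ e₂' ∈ E, e₁ ≠ e₂ → e₁' ≠ e₂' → τ e₁ = τ e₁' → τ e₂ = τ e₂' →
      A e₁ e₂ = A e₁' e₂')
    (v : α → ℝ) (d : T → ℝ) (hd' : ∀ e ∈ E, ∀ e' ∈ E, τ e = τ e' → e ≠ e' → d (τ e) = A e e - A e e') :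
    ∑ e ∈ E, ∑ e' ∈ E, v e * v e' * A e e' -
        ∑ e ∈ E, ∑ e' ∈ E,
          ((∑ x ∈ E.filter (fun x => τ x = τ e), v x) / ((E.filter (fun x => τ x = τ e)).card : ℝ)) *
            ((∑ x ∈ E.filter (fun x => τ x = τ e'), v x) / ((E.filter (fun x => τ x = τ e')).card : ℝ)) *
              A e e' =
      ∑ a ∈ Ty, d a *
        (∑ e ∈ E.filter (fun e => τ e = a), v e ^ 2 -
          (∑ e ∈ E.filter (fun e => τ e = a), v e) ^ 2 / ((E.filter (fun e => τ e = a)).card : ℝ)) := by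
  classical
  let kd : T → ℝ := fun a => (∑ x ∈ E.filter (fun x => τ x = a), A x x) / ((E.filter (fun x => τ x = a)).card : ℝ)
  let ko : T → T → ℝ := fun a b =>
    (∑ p ∈ ((E.filter (fun x => τ x = a)) ×ˢ (E.filter (fun x => τ x = b))).filter (fun p => p.1 ≠ p.2),
        A p.1 p.2) /
      ((((E.filter (fun x => τ x = a)) ×ˢ (E.filter (fun x => τ x = b))).filter (fun p => p.1 ≠ p.2)).card : ℝ)
  have hd : ∀ e ∈ E, A e e = kd (τ e) := fun e he => diag_eq_classAvg E τ A hdiag he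
  have ho : ∀ e ∈ E, ∀ e' ∈ E, e ≠ e' → A e e' = ko (τ e) (τ e') :=
    fun e he e' he' hne => offDiag_eq_classAvg E τ A hoff he he' hne
  rw [sum_sum_mul_mul_sub_typeAvg_eq E τ Ty hτ A kd ko hd ho v]
  refine sum_congr rfl fun a _ => ?_
  by_cases hm : 2 ≤ (E.filter (fun e => τ e = a)).card
  · obtain ⟨e, he, e', he', hne⟩ : ∃ e ∈ E.filter (fun x => τ x = a), ∃ e' ∈ E.filter (fun x => τ x = a), e ≠ e' :=
      one_lt_card.1 hm
    have heE := (mem_filter.1 he).1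
    have he'E := (mem_filter.1 he').1
    have hτe : τ e = a := (mem_filter.1 he).2
    have hτe' : τ e' = a := (mem_filter.1 he').2
    have h1 : kd a = A e e := by rw [← hτe]; exact (hd e heE).symm
    have h2 : ko a a = A e e' := by
      have := ho e heE e' he'E hne; rw [hτe, hτe'] at this; exact this.symm
    have h3 : d a = A e e - A e e' := by rw [← hτe]; exact hd' e heE e' he'E (hτe.trans hτe'.symm) hne
    rw [h1, h2, h3]
  · rw [sub_sq_div_card_eq_zero_of_card_le_one E τ v a (by omega), mul_zero, mul_zero]

end TypeSortedForm

end Literature.Combinatorics.Optimization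

end
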